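import Literature.NumberTheory.Automorphic.IdeleClassIntegration
import Literature.NumberTheory.Automorphic.IdeleNormOneSplitting
import HarnessLib

/-!
# `∫_{r(x) ∈ D, |x| < δ} |x|^s dν(x) ≤ A δ^s` on the idele group
(Gelbart, *Automorphic forms on adele groups* (1975), (9.45)–(9.46): the last step
`C_N ∫_{log ε}^∞ e^{2t} e^{-2Nt} dt → 0` of the estimate of `J_r + J_s` over the cusp, where `t`
is the logarithm of the split-torus coordinate and the norm-one part of the torus ranges over a
compact set)

Topic `NumberTheory/Automorphic`; theorems only. For a left invariant measure `ν` on `𝕀_K`, finite on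
compacta, a compact set `D ⊆ 𝕀_K` and `s > 0` there is `A < ∞` such that for every `δ > 0`

  `∫⁻ 1{r(x) ∈ D, |x|_𝔸 < δ} · |x|_𝔸^s dν(x) ≤ A · δ^s`

(`lintegral_indicator_normOneRetraction_mem_ideleNorm_lt_le`), where `r` is the norm-one retraction
of `IdeleNormOneSplitting` (`x = r(x) · z`, `z` a positive real idele). Proof: the region is covered
by the shells `S_j = {r(x) ∈ D, log δ - (j+1) < log|x| ≤ log δ - j}` (`j ∈ ℕ`), which are
translates by positive real ideles of the single relatively compact shell
`S = {r(x) ∈ D, -1 < log|x| ≤ 0}` (`r` is invariant under positive real ideles), hence all of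
measure `ν(S) < ∞`; on `S_j` the integrand is `≤ (δ e^{-j})^s`, and `Σ_j e^{-js} = (1 - e^{-s})⁻¹`.
Part of the inline (D-0026) decomposition of
`Literature.NumberTheory.Automorphic.jacquetLanglands_transfer_exists` (the `J`-part of the
parabolic term of the `GL₂` trace formula, with `GL2BorelCoveringBox`: the shadow `r(a₁/a₂) ∈ D₁`).

## References

* S. Gelbart, *Automorphic forms on adele groups*, Ann. of Math. Studies 83 (1975), (9.45)–(9.46)
  [Gelbart1975].
* J. W. S. Cassels, A. Fröhlich (eds.), *Algebraic Number Theory* (1967), Ch. XV §4.3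
  [CasselsFrohlichANT1967].
-/

noncomputable section

open MeasureTheory Measure Set Filter Topology IsDedekindDomain NumberField
open scoped ENNReal NNReal Pointwise

namespace Literature.NumberTheory.Automorphic

open Literature.NumberTheory.GaloisRepresentations (ideleGroup)

variable (K : Type) [Field K] [NumberField K]

/-- `r(z x) = r(x)` for a positive real idele `z`. [folklore] -/
theorem normOneRetraction_mul_of_mem_posRealIdeles {z : ideleGroup K} (hz : z ∈ posRealIdeles K)
    (x : ideleGroup K) : normOneRetraction K (z * x) = normOneRetraction K x := by
  rw [map_mul, normOneRetraction_eq_one_of_mem K hz, one_mul]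

/-- **Shells are translates of each other**: for a positive real idele `z` with `log |z| = c`,
`z • {r ∈ D, log|·| ∈ (a, b]} = {r ∈ D, log|·| ∈ (a + c, b + c]}`. [folklore] -/
theorem smul_shadowShell {z : ideleGroup K} (hz : z ∈ posRealIdeles K) (D : Set (ideleGroup K))
    (a b : ℝ) :
    z • {x : ideleGroup K | normOneRetraction K x ∈ D ∧ logNorm K x ∈ Ioc a b} =
      {x : ideleGroup K | normOneRetraction K x ∈ D ∧
        logNorm K x ∈ Ioc (a + logNorm K z) (b + logNorm K z)} := by
  ext x
  rw [Set.mem_smul_set_iff_inv_smul_mem, smul_eq_mul, Set.mem_setOf_eq, Set.mem_setOf_eq,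
    normOneRetraction_mul_of_mem_posRealIdeles K (inv_mem hz), logNorm_mul, logNorm_inv]
  simp only [mem_Ioc]
  constructor
  · rintro ⟨hD, h1, h2⟩; exact ⟨hD, by linarith, by linarith⟩
  · rintro ⟨hD, h1, h2⟩; exact ⟨hD, by linarith, by linarith⟩

/-- The shell `{r ∈ D, log|·| ∈ (a, b]}` lies in the compact `D · P_{[a,b]}`. [folklore] -/
theorem shadowShell_subset_mul (D : Set (ideleGroup K)) (a b : ℝ) :
    {x : ideleGroup K | normOneRetraction K x ∈ D ∧ logNorm K x ∈ Ioc a b} ⊆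
      D * posRealIdeleIcc K a b := by
  rintro x ⟨hD, hab⟩
  -- `x = r(x) · (r(x)⁻¹ x)` with `r(x)⁻¹ x` positive real of the same norm
  obtain ⟨t, ht⟩ := normOneRetraction_inv_mul_mem K x
  have h0 : logNorm K (normOneRetraction K x) = 0 := by
    rw [logNorm, ideleNorm_normOneRetraction, NNReal.coe_one, Real.log_one]
  have hnorm : logNorm K (posRealIdele K t) = logNorm K x := by
    rw [ht, logNorm_mul, logNorm_inv, h0, neg_zero, zero_add]
  obtain ⟨u, rfl⟩ : ∃ u : ℝ, expUnitNNReal u = t :=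
    ⟨Real.log ((t : ℝ≥0) : ℝ), Units.ext (NNReal.eq (by
      change Real.exp (Real.log _) = _
      exact Real.exp_log (NNReal.coe_pos.2 (pos_iff_ne_zero.2 t.ne_zero))))⟩
  rw [logNorm_posRealIdele_expUnitNNReal] at hnorm
  have hd : (0 : ℝ) < Module.finrank ℚ K := Nat.cast_pos.2 Module.finrank_pos
  refine ⟨normOneRetraction K x, hD, posRealIdele K (expUnitNNReal u), ⟨u, ⟨?_, ?_⟩, rfl⟩, ?_⟩
  · rw [div_le_iff₀ hd, mul_comm, hnorm]; exact hab.1.le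
  · rw [le_div_iff₀ hd, mul_comm, hnorm]; exact hab.2
  · beta_reduce
    rw [ht, mul_inv_cancel_left]

variable [MeasurableSpace (ideleGroup K)] [BorelSpace (ideleGroup K)]

/-- Shells are Borel. [folklore] -/
theorem measurableSet_shadowShell {D : Set (ideleGroup K)} (hD : IsClosed D) (a b : ℝ) :
    MeasurableSet {x : ideleGroup K | normOneRetraction K x ∈ D ∧ logNorm K x ∈ Ioc a b} :=
  ((hD.preimage (continuous_normOneRetraction K)).measurableSet).inter
    ((continuous_logNorm K).measurable measurableSet_Ioc)

/-- **`∫_{r(x) ∈ D, |x| < δ} |x|^s dν ≤ A δ^s`** for a left invariant measure `ν` on `𝕀_K` finite on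
compacta, `D` compact and `s > 0`, with `A < ∞` independent of `δ > 0` (shells and a geometric
series; Gelbart (1975), (9.45)–(9.46): `∫_{log ε}^∞ e^{2t} e^{-2Nt} dt`).
[cite: Gelbart1975, (9.45)–(9.46)] -/
theorem exists_lintegral_indicator_rpow_ideleNorm_le (ν : Measure (ideleGroup K)) [ν.IsMulLeftInvariant]
    [IsFiniteMeasureOnCompacts ν] {D : Set (ideleGroup K)} (hD : IsCompact D) {s : ℝ} (hs : 0 < s) :
    ∃ A : ℝ≥0∞, A ≠ ∞ ∧ ∀ δ : ℝ, 0 < δ →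
      ∫⁻ x, {x : ideleGroup K | normOneRetraction K x ∈ D ∧
          (IdeleClassGroup.ideleNorm K x : ℝ) < δ}.indicator
        (fun x => ENNReal.ofReal ((IdeleClassGroup.ideleNorm K x : ℝ) ^ s)) x ∂ν ≤
        A * ENNReal.ofReal (δ ^ s) := by
  haveI := locallyCompactSpace_ideleGroup K
  haveI := t2Space_ideleGroup K
  have hDcl : IsClosed D := hD.isClosed
  -- the reference shell and its measure
  set S : Set (ideleGroup K) :=
    {x : ideleGroup K | normOneRetraction K x ∈ D ∧ logNorm K x ∈ Ioc (-1) 0} with hS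
  have hSfin : ν S < ∞ :=
    lt_of_le_of_lt (measure_mono (shadowShell_subset_mul K D (-1) 0))
      ((hD.mul (isCompact_posRealIdeleIcc K (-1) 0)).measure_lt_top)
  set q : ℝ≥0∞ := ENNReal.ofReal (Real.exp (-s)) with hq
  have hq1 : q < 1 := by
    rw [hq, ENNReal.ofReal_lt_one, ← Real.exp_zero]
    exact Real.exp_lt_exp.2 (by linarith)
  refine ⟨ν S * (1 - q)⁻¹, ENNReal.mul_ne_top hSfin.ne
    (ENNReal.inv_ne_top.2 (tsub_pos_iff_lt.2 hq1).ne'), fun δ hδ => ?_⟩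
  -- the shells
  set Sh : ℕ → Set (ideleGroup K) := fun j =>
    {x : ideleGroup K | normOneRetraction K x ∈ D ∧
      logNorm K x ∈ Ioc (Real.log δ - (j + 1)) (Real.log δ - j)} with hSh
  have hShm : ∀ j, MeasurableSet (Sh j) := fun j => measurableSet_shadowShell K hDcl _ _
  -- each shell is a translate of `S`
  have hShν : ∀ j : ℕ, ν (Sh j) = ν S := by
    intro j
    obtain ⟨t, ht⟩ := exists_logNorm_posRealIdele_eq K (Real.log δ - j)
    have hz : posRealIdele K t ∈ posRealIdeles K := posRealIdele_mem_posRealIdeles K t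
    have hsm : posRealIdele K t • S = Sh j := by
      rw [hS, smul_shadowShell K hz, ht]
      ext x
      simp only [Set.mem_setOf_eq, mem_Ioc, hSh]
      constructor <;> rintro ⟨h1, h2, h3⟩ <;> exact ⟨h1, by linarith, by linarith⟩
    rw [← hsm, measure_smul]
  -- covering and the pointwise bound
  have hcover : ∀ x : ideleGroup K, normOneRetraction K x ∈ D →
      (IdeleClassGroup.ideleNorm K x : ℝ) < δ → ∃ j, x ∈ Sh j := by
    intro x hxD hxδ
    have hlt : logNorm K x < Real.log δ := Real.log_lt_log (ideleNorm_real_pos x) hxδ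
    set y : ℝ := Real.log δ - logNorm K x with hy
    have hy0 : 0 ≤ y := by rw [hy]; linarith
    refine ⟨⌊y⌋₊, hxD, ?_, ?_⟩
    · have := Nat.lt_floor_add_one y
      rw [hy] at this; linarith
    · have := Nat.floor_le hy0
      rw [hy] at this; linarith
  have hbound : ∀ j : ℕ, ∀ x ∈ Sh j,
      ENNReal.ofReal ((IdeleClassGroup.ideleNorm K x : ℝ) ^ s) ≤ ENNReal.ofReal (δ ^ s) * q ^ j := by
    intro j x hx
    have h2 : (IdeleClassGroup.ideleNorm K x : ℝ) ≤ δ * Real.exp (-(j : ℝ)) := by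
      rw [← exp_logNorm, ← Real.exp_log hδ, ← Real.exp_add]
      exact Real.exp_le_exp.2 (by have := hx.2.2; linarith)
    have h3 : (IdeleClassGroup.ideleNorm K x : ℝ) ^ s ≤ (δ * Real.exp (-(j : ℝ))) ^ s :=
      Real.rpow_le_rpow (ideleNorm_real_pos x).le h2 hs.le
    have h4 : (δ * Real.exp (-(j : ℝ))) ^ s = δ ^ s * Real.exp (-s) ^ j := by
      rw [Real.mul_rpow hδ.le (Real.exp_pos _).le, ← Real.exp_mul, ← Real.exp_nat_mul]
      congr 2
      ring
    calc ENNReal.ofReal ((IdeleClassGroup.ideleNorm K x : ℝ) ^ s)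
        ≤ ENNReal.ofReal ((δ * Real.exp (-(j : ℝ))) ^ s) := ENNReal.ofReal_le_ofReal h3
      _ = ENNReal.ofReal (δ ^ s) * q ^ j := by
          rw [h4, ENNReal.ofReal_mul (Real.rpow_nonneg hδ.le _), hq,
            ← ENNReal.ofReal_pow (Real.exp_pos _).le]
  -- measurability of the integrand
  have hfm : Measurable fun x : ideleGroup K =>
      ENNReal.ofReal ((IdeleClassGroup.ideleNorm K x : ℝ) ^ s) := by
    refine ENNReal.measurable_ofReal.comp ?_
    exact (NNReal.continuous_coe.comp (continuous_ideleNorm_holds K)).measurable.pow_const s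
  -- assemble
  calc ∫⁻ x, {x : ideleGroup K | normOneRetraction K x ∈ D ∧
          (IdeleClassGroup.ideleNorm K x : ℝ) < δ}.indicator
          (fun x => ENNReal.ofReal ((IdeleClassGroup.ideleNorm K x : ℝ) ^ s)) x ∂ν
      ≤ ∫⁻ x, ∑' j : ℕ, (Sh j).indicator
          (fun x => ENNReal.ofReal ((IdeleClassGroup.ideleNorm K x : ℝ) ^ s)) x ∂ν := by
        refine lintegral_mono fun x => ?_
        by_cases hx : x ∈ {x : ideleGroup K | normOneRetraction K x ∈ D ∧
            (IdeleClassGroup.ideleNorm K x : ℝ) < δ}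
        · obtain ⟨j, hj⟩ := hcover x hx.1 hx.2
          rw [Set.indicator_of_mem hx]
          refine le_trans ?_ (ENNReal.le_tsum j)
          rw [Set.indicator_of_mem hj]
        · rw [Set.indicator_of_notMem hx]
          exact bot_le
    _ = ∑' j : ℕ, ∫⁻ x, (Sh j).indicator
          (fun x => ENNReal.ofReal ((IdeleClassGroup.ideleNorm K x : ℝ) ^ s)) x ∂ν :=
        lintegral_tsum fun j => ((hfm.indicator (hShm j))).aemeasurable
    _ ≤ ∑' j : ℕ, ∫⁻ x, (Sh j).indicator (fun _ => ENNReal.ofReal (δ ^ s) * q ^ j) x ∂ν := by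
        refine ENNReal.tsum_le_tsum fun j => lintegral_mono fun x => ?_
        by_cases hx : x ∈ Sh j
        · rw [Set.indicator_of_mem hx, Set.indicator_of_mem hx]
          exact hbound j x hx
        · rw [Set.indicator_of_notMem hx, Set.indicator_of_notMem hx]
    _ = ∑' j : ℕ, ENNReal.ofReal (δ ^ s) * q ^ j * ν S := by
        refine tsum_congr fun j => ?_
        rw [lintegral_indicator_const (hShm j), hShν j]
    _ = ν S * (1 - q)⁻¹ * ENNReal.ofReal (δ ^ s) := by
        rw [← ENNReal.tsum_geometric, ← ENNReal.tsum_mul_left, ← ENNReal.tsum_mul_right]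
        refine tsum_congr fun j => ?_
        ring

end Literature.NumberTheory.Automorphic
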